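import Summits.ResolutionOfSingularities.ResolutionOfSingularities.Theorems.FrobeniusClosingSteerGrConeQuotient
import HarnessLib

/-!
# Crux `Steer` (stmt-ResolutionOfSingularities-16345), chain W4.1 — K-β0(b) gr bridge, brick (G3c):
# CONE TRANSPORT ACROSS ONE POINT STEP in gr currency — no completion, no coefficient field, any residue field (rational centre)

OURS (campaign `res-hironaka`, rung L ★L-G4, slot W4.1; seat res-L0-w41-stub-4 g7 on res-L0-w41-plan-1 RULINGS 268(a)/282(f) «(G3) point-step cone
transport in gr currency»). Replaces the role of no printed item; NOT a statement of the manuscript under review [claim: Hironaka2017, status: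
under-review]; AI-produced, weaker than expert review. Theses-free, definition-free, words-free.

SETTING. `R′` a regular local ring with r.s.o.p. `(x₁, v₁, z₁, w₁)` (the member `R (i+1)` at a RATIONAL near point of a point step, `x₁` the
exceptional parameter). The previous member enters only through its SHADOW: an element `B ∈ R′` (the strict transform `f/x₁^d`, brick (G2)) with
`B ≡ Σ_(j<J) F_j(v₁, z₁, w₁) (mod x₁)` for forms `F_j` of degree `j` ALL of whose coefficients are UNITS OR MULTIPLES OF `x₁` (images of the
previous member at a point step: `φ(𝔪) ⊆ x₁R′`), the cone `Ψ̄` of the previous stage being the `V`-free part of `F̄_d` (`≠ 0`); the radicand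
relation `x₁^(a+b)·(c̃ + v₁)^b · x₁^d B = x₁^(2k+a₁)·v₁^(b₁)·f₁` (twists `u = x^a y^b ↦ x₁^(a+b)(c̃+v₁)^b`, `u₁ = x₁^(a₁) v₁^(b₁)`; `b ≤ 1`;
`c̃` a unit — chart point `c ≠ 0` — or `0`); and the next stage's congruence `f₁ ≡ Ψ₁(z₁,w₁) (mod (x₁,v₁)·𝔪′^(d−1) + 𝔪′^(d+1))`, `Ψ̄₁ ≠ 0`.
* **`grConeTransport_pointStep`** — `Ψ̄₁ = λ · (V-free part of F̄_d)` for a nonzero `λ ∈ κ′` (`λ = c̄^b`, resp. `1` when `c̃ = 0`).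
PROOF. `x₁`-cancellation in the domain `R′` and primality of `x₁` force `a + b + d = 2k + a₁` (else the shadow `S = Σ F̄_j(ȳ)` or `f̄₁`
would vanish in `R̄ = R′/(x₁)` while having finite order by (G1)/(G3a)); then `(c̄ + v̄)^b · S = v̄^(b₁) · f̄₁` in the regular local ring `R̄`
(`gr = κ′[V,Z,W]`): the right side has order `d + b₁` and initial form `V^(b₁)·(Ψ̄₁ + V·H̄)` ((G1)); the left side has the order and initial form
of the LOWEST nonzero shadow form, its coefficients being units or ZERO in `R̄` ((G3a)); comparing pins the twists and gives the identity of initial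
forms in `κ′[V,Z,W]`, whence the claim by killing `V` (and pulling back along the injective `κ′ → κ̄`). No hat, no section, no perfectness.
The run-level consumer feeds `F` from (G2) `…NearPointInitialForm` (dehomogenised initial form through `ChartRsop.closure_chartQuotient_X`) and the
per-letter words strat-2 types ((B4)/(T), RULING 268(a3)); the non-rational centre (κ′ = κ(c), `V := m̃_c(y/x)`) is the same proof over `R̄` — booked.

[cite: CossartJannsenSaito2020, §2.2, Lemma 12.1 (2)] [folklore]
bears_on: LADDER-RESOLUTION L ★L-G4 W4.1 (crux `Steer`, binder hK4ⁿᶜ, K-β0(b) `ArithTransportTwoN`, gr bridge (G3)).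
-/

noncomputable section

-- `Summit.<S>.<S>.…` duplicates the summit name by design (single-problem summit).
set_option linter.dupNamespace false

open IsLocalRing MvPolynomial
open Literature.RingTheory.HilbertSamuel Literature.AlgebraicGeometry.Resolution

namespace Summit.ResolutionOfSingularities.ResolutionOfSingularities.Theorems.SwitchingDichotomy.NearPoint

universe u

/-! ## §6 THE TRANSPORT -/

section Main
variable {R' : Type u} [CommRing R'] [IsLocalRing R']

/-- **CONE TRANSPORT ACROSS ONE POINT STEP (gr currency, rational centre).** See the module docstring. The source shadow is given as a finite family
of forms `F j` of degree `j` over `R′` (`j < J`, `d < J`) with coefficients «unit or multiple of `x₁`» and `B ≡ Σ_j F_j(v₁, z₁, w₁) (mod x₁)`; the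
cone `Ψ̄` of the previous stage is the `V`-free part of `F̄_d` (hypothesis `hFd : … ≠ 0`); the conclusion identifies `Ψ̄₁` with `λ` times it. -/
theorem grConeTransport_pointStep (hreg : IsRegularLocalRing R') (hfr : (maximalIdeal R').spanFinrank = 4) (x₁ v₁ z₁ w₁ : R')
    (hspan : Ideal.span {x₁, v₁, z₁, w₁} = maximalIdeal R')
    (ct B f₁ : R') (a b a₁ b₁ k d J : ℕ) (hb : b ≤ 1) (hd : 1 ≤ d) (hdJ : d < J) (hc : IsUnit ct ∨ ct = 0)
    (hrel : x₁ ^ (a + b) * (ct + v₁) ^ b * (x₁ ^ d * B) = x₁ ^ (2 * k + a₁) * v₁ ^ b₁ * f₁)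
    (F : ℕ → MvPolynomial (Fin 3) R') (hF : ∀ j, (F j).IsHomogeneous j)
    (hFc : ∀ j m, IsUnit (coeff m (F j)) ∨ coeff m (F j) ∈ Ideal.span {x₁})
    (hB : B - ∑ j ∈ Finset.range J, eval ![v₁, z₁, w₁] (F j) ∈ Ideal.span {x₁})
    (hFd : aeval (![0, X 0, X 1] : Fin 3 → MvPolynomial (Fin 2) (ResidueField R')) (MvPolynomial.map (residue R') (F d)) ≠ 0)
    (Ψ₁ : MvPolynomial (Fin 2) R') (hΨ₁ : Ψ₁.IsHomogeneous d)
    (hcong₁ : f₁ - eval ![z₁, w₁] Ψ₁ ∈ Ideal.span {x₁, v₁} * maximalIdeal R' ^ (d - 1) ⊔ maximalIdeal R' ^ (d + 1))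
    (hΨ₁0 : MvPolynomial.map (residue R') Ψ₁ ≠ 0) :
    ∃ l : ResidueField R', l ≠ 0 ∧ MvPolynomial.map (residue R') Ψ₁ =
      C l * aeval (![0, X 0, X 1] : Fin 3 → MvPolynomial (Fin 2) (ResidueField R')) (MvPolynomial.map (residue R') (F d)) := by
  classical
  haveI := hreg
  haveI : IsDomain R' := isDomain_of_isRegularLocalRing R'
  -- §A. the exceptional parameter
  have hx₁ : x₁ ∈ maximalIdeal R' := hspan ▸ Ideal.subset_span (by simp)
  have hv₁ : v₁ ∈ maximalIdeal R' := hspan ▸ Ideal.subset_span (by simp)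
  have hx₁sq : x₁ ∉ maximalIdeal R' ^ 2 := not_mem_sq_of_quad hfr hspan (Or.inl rfl)
  have hx₁0 : x₁ ≠ 0 := fun h => hx₁sq (h ▸ zero_mem _)
  have hprime : Prime x₁ := IsRegularLocalRing.prime_of_not_mem_sq hx₁ hx₁sq
  -- §B. the quotient `R̄ = R′/(x₁)`
  haveI hnt : Nontrivial (R' ⧸ Ideal.span {x₁}) :=
    Ideal.Quotient.nontrivial_iff.mpr (Ideal.span_singleton_ne_top ((mem_maximalIdeal x₁).mp hx₁))
  haveI hloc := IsLocalRing.of_surjective' (Ideal.Quotient.mk (Ideal.span {x₁})) Ideal.Quotient.mk_surjective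
  obtain ⟨hregbar, hfrbar, hyb, hvb0⟩ := quotient_exc_param hreg hfr hspan
  haveI := hregbar
  haveI : IsDomain (R' ⧸ Ideal.span {x₁}) := isDomain_of_isRegularLocalRing _
  set π := Ideal.Quotient.mk (Ideal.span {x₁}) with hπ
  set yb : Fin 3 → R' ⧸ Ideal.span {x₁} := ![π v₁, π z₁, π w₁] with hybdef
  have hπx : π x₁ = 0 := Ideal.Quotient.eq_zero_iff_mem.mpr (Ideal.subset_span rfl)
  have hπdvd : ∀ t : R', π t = 0 ↔ x₁ ∣ t := fun t => by
    rw [Ideal.Quotient.eq_zero_iff_mem, Ideal.mem_span_singleton]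
  have hvbm : π v₁ ∈ maximalIdeal (R' ⧸ Ideal.span {x₁}) := hyb ▸ Ideal.subset_span ⟨0, rfl⟩
  -- residue fields: `θ : κ′ → κ̄` injective with `θ ∘ residue′ = residuē ∘ π`
  haveI : IsLocalHom π := IsLocalHom.of_surjective _ Ideal.Quotient.mk_surjective
  set θ : ResidueField R' →+* ResidueField (R' ⧸ Ideal.span {x₁}) := ResidueField.map π with hθ
  have hθres : ∀ t : R', θ (residue R' t) = residue _ (π t) := fun t => ResidueField.map_residue π t
  have hθcomp : θ.comp (residue R') = (residue _).comp π := RingHom.ext hθres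
  have hθinj : Function.Injective θ := RingHom.injective θ
  -- §C. the shadow of `B`: forms `G j` over `R̄` with unit-or-zero coefficients
  set G : ℕ → MvPolynomial (Fin 3) (R' ⧸ Ideal.span {x₁}) := fun j => MvPolynomial.map π (F j) with hG
  have hGh : ∀ j, (G j).IsHomogeneous j := fun j => (hF j).map _
  have hGc : ∀ j m, IsUnit (coeff m (G j)) ∨ coeff m (G j) = 0 := fun j => unitOrZero_map_mk _ _ (hFc j)
  have hGne : ∀ j, G j ≠ 0 → MvPolynomial.map (residue _) (G j) ≠ 0 := fun j hj h0 =>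
    hj (eq_zero_of_map_residue_eq_zero_of_unitOrZero _ (hGc j) h0)
  have hGres : ∀ j, MvPolynomial.map (residue _) (G j) = MvPolynomial.map θ (MvPolynomial.map (residue R') (F j)) := fun j => by
    rw [hG, MvPolynomial.map_map, MvPolynomial.map_map, hθcomp]
  set S := ∑ j ∈ Finset.range J, eval yb (G j) with hS
  have hBS : π B = S := by
    have h := (Ideal.Quotient.eq_zero_iff_mem).mpr hB
    rw [map_sub, sub_eq_zero, map_sum] at h
    rw [h, hS]
    refine Finset.sum_congr rfl fun j _ => ?_
    rw [hG, MvPolynomial.eval_map, MvPolynomial.eval₂_comp]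
    congr 1
    funext i; fin_cases i <;> rfl
  -- `G d ≠ 0`: its `V`-free reduction is `θ`(the cone) ≠ 0
  have hkill_d : bind₁ (![0, X 0, X 1] : Fin 3 → MvPolynomial (Fin 2) _) (MvPolynomial.map (residue _) (G d)) =
      MvPolynomial.map θ (aeval (![0, X 0, X 1] : Fin 3 → MvPolynomial (Fin 2) (ResidueField R'))
        (MvPolynomial.map (residue R') (F d))) := by
    rw [hGres, aeval_eq_bind₁, map_bind₁_kill]
  have hGd : G d ≠ 0 := by
    intro h0
    apply hFd
    have h1 : MvPolynomial.map θ (aeval (![0, X 0, X 1] : Fin 3 → MvPolynomial (Fin 2) (ResidueField R'))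
        (MvPolynomial.map (residue R') (F d))) = 0 := by
      rw [← hkill_d, h0, map_zero, map_zero]
    exact MvPolynomial.map_injective θ hθinj (h1.trans (map_zero _).symm)
  -- the lowest nonzero shadow form
  obtain ⟨j₀, hj₀J, hGj₀, hlow⟩ := exists_lowest J G ⟨d, hdJ, hGd⟩
  have hj₀d : j₀ ≤ d := by
    by_contra h
    exact hGd (hlow d (by omega))
  have hGj₀res : MvPolynomial.map (residue _) (G j₀) ≠ 0 := hGne j₀ hGj₀
  have hSlow : S - eval yb (G j₀) ∈ maximalIdeal (R' ⧸ Ideal.span {x₁}) ^ (j₀ + 1) :=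
    sub_eval_mem_pow_of_lowest yb hyb J G hGh j₀ hj₀J hlow
  -- §D. the target in `R̄`
  obtain ⟨H, hH, hcongbar⟩ := target_congruence_quotient Ψ₁ hcong₁ hyb
  set F₁' : MvPolynomial (Fin 3) (R' ⧸ Ideal.span {x₁}) := rename Fin.succ (MvPolynomial.map π Ψ₁) + X 0 * H with hF₁'
  have hF₁'h : F₁'.IsHomogeneous d := by
    refine IsHomogeneous.add ((hΨ₁.map π).rename_isHomogeneous) ?_
    have := (isHomogeneous_X (R' ⧸ Ideal.span {x₁}) (0 : Fin 3)).mul hH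
    rwa [show 1 + (d - 1) = d by omega] at this
  -- reduction of `F₁'`: `V`-free part `= θ(Ψ̄₁) ≠ 0`
  have hkill₁ : bind₁ (![0, X 0, X 1] : Fin 3 → MvPolynomial (Fin 2) _) (MvPolynomial.map (residue _) F₁') =
      MvPolynomial.map θ (MvPolynomial.map (residue R') Ψ₁) := by
    rw [hF₁', map_add, map_add, map_mul, map_X, bind₁_kill_X_zero_mul, add_zero, map_rename, bind₁_kill_rename_succ,
      MvPolynomial.map_map, MvPolynomial.map_map, hθcomp]
  have hF₁'res : MvPolynomial.map (residue _) F₁' ≠ 0 := by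
    intro h0
    apply hΨ₁0
    have h1 : MvPolynomial.map θ (MvPolynomial.map (residue R') Ψ₁) = 0 := by rw [← hkill₁, h0, map_zero]
    exact MvPolynomial.map_injective θ hθinj (h1.trans (map_zero _).symm)
  -- the target side: `v̄^b₁ · f̄₁` has order `d + b₁` and initial form `V^b₁ · F̄₁'`
  have hVF₁h : (X (0 : Fin 3) ^ b₁ * F₁').IsHomogeneous (d + b₁) := by
    have := ((isHomogeneous_X (R' ⧸ Ideal.span {x₁}) (0 : Fin 3)).pow b₁).mul hF₁'h
    rwa [show 1 * b₁ + d = d + b₁ by ring] at this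
  have hVF₁res : MvPolynomial.map (residue _) (X (0 : Fin 3) ^ b₁ * F₁') ≠ 0 := by
    rw [map_mul, map_pow, map_X]
    exact mul_ne_zero (pow_ne_zero _ (X_ne_zero 0)) hF₁'res
  have hcongV : π v₁ ^ b₁ * π f₁ - eval yb (X 0 ^ b₁ * F₁') ∈ maximalIdeal _ ^ (d + b₁ + 1) :=
    sub_eval_X_pow_mul_mem yb hyb hcongbar 0 b₁
  have hordR : mOrder (π v₁ ^ b₁ * π f₁) = ((d + b₁ : ℕ) : ℕ∞) :=
    mOrder_eq_of_congruence hfrbar yb hyb _ _ hVF₁h hVF₁res _ hcongV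
  have hinR : inForm yb (π v₁ ^ b₁ * π f₁) = MvPolynomial.map (residue _) (X 0 ^ b₁ * F₁') :=
    inForm_eq_of_congruence hfrbar yb hyb _ _ hVF₁h hVF₁res _ hcongV
  -- §E. the exponent comparison `a + b + d = 2k + a₁`
  have hrel' : x₁ ^ (a + b + d) * ((ct + v₁) ^ b * B) = x₁ ^ (2 * k + a₁) * (v₁ ^ b₁ * f₁) := by
    calc x₁ ^ (a + b + d) * ((ct + v₁) ^ b * B) = x₁ ^ (a + b) * (ct + v₁) ^ b * (x₁ ^ d * B) := by ring
      _ = x₁ ^ (2 * k + a₁) * v₁ ^ b₁ * f₁ := hrel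
      _ = x₁ ^ (2 * k + a₁) * (v₁ ^ b₁ * f₁) := by ring
  have hcv : π (ct + v₁) ≠ 0 := by
    rcases hc with hu | h0
    · rw [map_add]; exact (isUnit_add_of_mem_maximalIdeal (hu.map π) hvbm).ne_zero
    · rw [h0, zero_add]; exact hvb0
  have hordS : mOrder S = ((j₀ : ℕ) : ℕ∞) := mOrder_eq_of_lowest hfrbar yb hyb J G hGh j₀ hj₀J hlow hGj₀res
  have hNM : a + b + d = 2 * k + a₁ := by
    rcases lt_trichotomy (a + b + d) (2 * k + a₁) with hlt | heq | hgt
    · exfalso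
      have h1 : (ct + v₁) ^ b * B = x₁ ^ (2 * k + a₁ - (a + b + d)) * (v₁ ^ b₁ * f₁) := by
        have hx : x₁ ^ (2 * k + a₁) = x₁ ^ (a + b + d) * x₁ ^ (2 * k + a₁ - (a + b + d)) := by
          rw [← pow_add]; congr 1; omega
        rw [hx, mul_assoc] at hrel'
        exact mul_left_cancel₀ (pow_ne_zero _ hx₁0) hrel'
      have h2 : π ((ct + v₁) ^ b) * π B = 0 := by
        rw [← map_mul, h1, map_mul, map_pow, hπx, zero_pow (by omega), zero_mul]
      rcases mul_eq_zero.mp h2 with h3 | h3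
      · rw [map_pow] at h3
        exact hcv (pow_eq_zero_iff'.mp h3).1
      · rw [hBS] at h3
        rw [h3, (mOrder_eq_top_iff_eq_zero (0 : R' ⧸ Ideal.span {x₁})).mpr rfl] at hordS
        exact ENat.top_ne_coe _ hordS
    · exact heq
    · exfalso
      have h1 : x₁ ^ (a + b + d - (2 * k + a₁)) * ((ct + v₁) ^ b * B) = v₁ ^ b₁ * f₁ := by
        have hx : x₁ ^ (a + b + d) = x₁ ^ (2 * k + a₁) * x₁ ^ (a + b + d - (2 * k + a₁)) := by
          rw [← pow_add]; congr 1; omega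
        rw [hx, mul_assoc] at hrel'
        exact mul_left_cancel₀ (pow_ne_zero _ hx₁0) hrel'
      have h2 : π (v₁ ^ b₁) * π f₁ = 0 := by
        rw [← map_mul, ← h1, map_mul, map_pow, hπx, zero_pow (by omega), zero_mul]
      have h3 : π f₁ = 0 := by
        rcases mul_eq_zero.mp h2 with h | h
        · rw [map_pow] at h
          exact absurd (pow_eq_zero_iff'.mp h).1 hvb0
        · exact h
      have hord1 : mOrder (π f₁) = ((d : ℕ) : ℕ∞) := mOrder_eq_of_congruence hfrbar yb hyb d F₁' hF₁'h hF₁'res _ hcongbar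
      rw [h3, (mOrder_eq_top_iff_eq_zero (0 : R' ⧸ Ideal.span {x₁})).mpr rfl] at hord1
      exact ENat.top_ne_coe _ hord1
  -- §F. `(♠)` in `R̄`: `π(ct + v₁)^b · S = v̄^b₁ · f̄₁`
  have hspade : π (ct + v₁) ^ b * S = π v₁ ^ b₁ * π f₁ := by
    have h1 : (ct + v₁) ^ b * B = v₁ ^ b₁ * f₁ := by
      rw [hNM] at hrel'
      exact mul_left_cancel₀ (pow_ne_zero _ hx₁0) hrel'
    have := congrArg π h1
    rwa [map_mul, map_pow, map_mul, map_pow, hBS] at this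
  -- §G. orders and initial forms of the left side; conclusion
  -- the `V`-free part of `Ḡ j₀` when `j₀ = d`, transported
  have hkill_eq : ∀ (l : ResidueField R'),
      MvPolynomial.map θ (MvPolynomial.map (residue R') Ψ₁) =
        C (θ l) * bind₁ (![0, X 0, X 1] : Fin 3 → MvPolynomial (Fin 2) _) (MvPolynomial.map (residue _) (G d)) →
      MvPolynomial.map (residue R') Ψ₁ =
        C l * aeval (![0, X 0, X 1] : Fin 3 → MvPolynomial (Fin 2) (ResidueField R')) (MvPolynomial.map (residue R') (F d)) := by
    intro l h
    apply MvPolynomial.map_injective θ hθinj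
    rw [h, map_mul, map_C, hkill_d]
  rcases hc with hu | h0
  · -- UNIT CASE: `λ = c̄^b`, forces `b₁ = 0`
    have hU : IsUnit (π (ct + v₁)) := by rw [map_add]; exact isUnit_add_of_mem_maximalIdeal (hu.map π) hvbm
    have hUres : residue _ (π (ct + v₁)) = θ (residue R' ct) := by
      rw [hθres, map_add, map_add, (residue_eq_zero_iff _).mpr hvbm, add_zero]
    have hUres0 : residue _ (π (ct + v₁) ^ b) ≠ 0 := by
      rw [map_pow]; exact pow_ne_zero _ ((residue_ne_zero_iff_isUnit _).mpr hU)
    have hLh : (C (π (ct + v₁) ^ b) * G j₀).IsHomogeneous j₀ := by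
      simpa using (isHomogeneous_C (Fin 3) (π (ct + v₁) ^ b)).mul (hGh j₀)
    have hLres : MvPolynomial.map (residue _) (C (π (ct + v₁) ^ b) * G j₀) ≠ 0 := by
      rw [map_mul, map_C]; exact mul_ne_zero (fun h => hUres0 (C_eq_zero.mp h)) hGj₀res
    have hcongL : π (ct + v₁) ^ b * S - eval yb (C (π (ct + v₁) ^ b) * G j₀) ∈ maximalIdeal _ ^ (j₀ + 1) :=
      sub_eval_C_mul_mem yb hSlow _
    have hordL : mOrder (π (ct + v₁) ^ b * S) = ((j₀ : ℕ) : ℕ∞) := mOrder_eq_of_congruence hfrbar yb hyb _ _ hLh hLres _ hcongL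
    have hinL : inForm yb (π (ct + v₁) ^ b * S) = MvPolynomial.map (residue _) (C (π (ct + v₁) ^ b) * G j₀) :=
      inForm_eq_of_congruence hfrbar yb hyb _ _ hLh hLres _ hcongL
    rw [hspade, hordR] at hordL
    have hj : d + b₁ = j₀ := by exact_mod_cast hordL
    have hb₁ : b₁ = 0 := by omega
    have hj₀ : j₀ = d := by omega
    rw [hspade, hinR, hb₁, pow_zero, one_mul, hj₀, map_mul, map_C] at hinL
    -- kill `V`: `θ Ψ̄₁ = (c̄^b) · (V-free part of Ḡ d)`
    refine ⟨residue R' ct ^ b, pow_ne_zero _ ((residue_ne_zero_iff_isUnit ct).mpr hu), hkill_eq _ ?_⟩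
    have := congrArg (bind₁ (![0, X 0, X 1] : Fin 3 → MvPolynomial (Fin 2) _)) hinL
    rw [hkill₁, map_mul, bind₁_C_right] at this
    rw [this, map_pow, hUres, map_pow, map_pow, ← map_pow C]
  · -- `c̃ = 0` CASE: `λ = 1`, forces `b = b₁` (or kills `Ψ̄₁`)
    have h0' : π (ct + v₁) = π v₁ := by rw [h0, zero_add]
    rw [h0'] at hspade
    have hLh : (X (0 : Fin 3) ^ b * G j₀).IsHomogeneous (j₀ + b) := by
      have := ((isHomogeneous_X (R' ⧸ Ideal.span {x₁}) (0 : Fin 3)).pow b).mul (hGh j₀)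
      rwa [show 1 * b + j₀ = j₀ + b by ring] at this
    have hLres : MvPolynomial.map (residue _) (X (0 : Fin 3) ^ b * G j₀) ≠ 0 := by
      rw [map_mul, map_pow, map_X]
      exact mul_ne_zero (pow_ne_zero _ (X_ne_zero 0)) hGj₀res
    have hcongL : π v₁ ^ b * S - eval yb (X 0 ^ b * G j₀) ∈ maximalIdeal _ ^ (j₀ + b + 1) :=
      sub_eval_X_pow_mul_mem yb hyb hSlow 0 b
    have hordL : mOrder (π v₁ ^ b * S) = ((j₀ + b : ℕ) : ℕ∞) := mOrder_eq_of_congruence hfrbar yb hyb _ _ hLh hLres _ hcongL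
    have hinL : inForm yb (π v₁ ^ b * S) = MvPolynomial.map (residue _) (X (0 : Fin 3) ^ b * G j₀) :=
      inForm_eq_of_congruence hfrbar yb hyb _ _ hLh hLres _ hcongL
    rw [hspade, hordR] at hordL
    have hj : d + b₁ = j₀ + b := by exact_mod_cast hordL
    rw [hspade, hinR, map_mul, map_pow, map_X, map_mul, map_pow, map_X] at hinL
    by_cases hjd : j₀ = d
    · have hbb : b₁ = b := by omega
      rw [hbb, hjd] at hinL
      have hcancel := mul_left_cancel₀ (pow_ne_zero b (X_ne_zero (0 : Fin 3))) hinL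
      refine ⟨1, one_ne_zero, hkill_eq 1 ?_⟩
      rw [map_one, C_1, one_mul]
      have := congrArg (bind₁ (![0, X 0, X 1] : Fin 3 → MvPolynomial (Fin 2) _)) hcancel
      rw [hkill₁] at this
      exact this
    · exfalso
      have hb1 : b = 1 := by omega
      have hb0 : b₁ = 0 := by omega
      rw [hb1, hb0, pow_zero, one_mul, pow_one] at hinL
      have := congrArg (bind₁ (![0, X 0, X 1] : Fin 3 → MvPolynomial (Fin 2) _)) hinL
      rw [hkill₁, bind₁_kill_X_zero_mul] at this
      apply hΨ₁0
      exact MvPolynomial.map_injective θ hθinj (this.trans (map_zero _).symm)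

end Main
end Summit.ResolutionOfSingularities.ResolutionOfSingularities.Theorems.SwitchingDichotomy.NearPoint

end
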